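import Summits.PneNP.PneNP.Theorems.NegLimitedHalfWindowMonotoneAmplificationGen
import Summits.PneNP.PneNP.Theorems.NegLimitedDoorFKGMixtures
import Literature.Computability.Complexity.CliqueTestGraphs
import Mathlib
import HarnessLib

/-!
# Route NegLimited — line `half-window`, stub `stub_halfEngineAssembly` (rung F-N1/p3, ROUND-13)

Registered stub (EA′) of the skeleton `half-window` on the rung item `NegLimited.NeglimitedHalfLogNegationsR`
(stmt-PneNP-19888; HOME/pnp-ideate-p3/r13/half-window.lean; card r13/half-window.md; BLUEPRINT-R2.md §EA′):

  `HalfEngineAssembly := CriticalWindowHardness → MonotoneAmplificationGen → TribesBiasResponse →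
     TribesNumericsCal → TribesRM3Count → HalfEngine`.

Pure assembly (pattern of the door's `stub_engineAssembly`, p466977).  Given `ε₁ > 0`, `r ≥ 1`, `c`: the base (B)
at exponent `c` gives `β`, a clique size `kc` and, eventually in `n`, an exactly balanced FKG-lattice weight `μ`
on the edge cube under which `CLIQUE(n,kc)` is `β`-hard for size-`n^c` `{∧,∨,0,1}`-circuits; the engine's weight
is the block product `ν = μ^{⊗ HBlk n r}` (written with `Amp.bw`; FKG by `NegLimitedDoor.fkg_blockProduct`, total mass `1` by
`Amp.sum_bw_eq_prod`).  A-gen (constant `K`) bounds the agreement of any `{∧,∨,0,1}`-circuit `M` with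
`(|M|+1)·K·hP^e ≤ n^c` by `½ + expAbsBiasGen Φ (β/2)/2 + hP⁻¹`, TB bounds the expected bias by
`tbRHS w m d (β/2)` and N (constant `K₂` at `ε = ε₁`, `p = β/2`) by `K₂·hP^{-(1/2−ε₁)}` along `w = wOf n r → ∞`;
near-balance: by the pushforward (`Amp.pushforward_holds`) and the count C the `ν`-mass of `halfFn = 1` is
exactly `1 − (1 − 2^{-w})^m`, so the imbalance is half the first term of `tbRHS`.  `K₃ := max K (K₂/2 + 1)`.

HONEST FRAMING: assembly only (zero new mathematics); B is the landed `stub_criticalWindow` (p472908) but A-gen,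
TB, N, C are hypotheses here; FRONTIER rung F-N1 — nothing here bears on P vs NP.
-/

set_option linter.dupNamespace false -- `Summit.PneNP.PneNP.…`: summit = sub-problem name (D-0017 single-conjunct layout)

namespace Summit.PneNP.PneNP.Theorems.NegLimitedHalfWindow

open Finset Filter
open Literature.Computability.Complexity
open Summit.PneNP.PneNP.Theorems.NegLimitedDoor (massAt agreeAt massAt_false_add_massAt_true)
open Summit.PneNP.PneNP.Theorems.NegLimitedAmplifiedWindow (Edge CriticalWindowHardness)
open Summit.PneNP.PneNP.Theorems.NegLimitedAmplifiedWindow.Amp (bw bw_nonneg sum_bw_eq_prod pushforward_holds)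
open Summit.PneNP.PneNP.Theorems.CliqueExtLowerBound.Negative (MonoBasis MonoBasis.monotoneBasis01 cktSize_const01)

/-! ### Bookkeeping on the objects -/

/-- `|HBlk n r| = hP n r`. -/
theorem card_HBlk (n r : ℕ) : Fintype.card (HBlk n r) = hP n r := by
  simp only [HBlk, hP, Fintype.card_prod, Fintype.card_fun, Fintype.card_fin]

/-- `2^{w−1} ≤ mCal w` for `1 ≤ w` (the `j = 1` term of the calibration sum). -/
theorem two_pow_le_mCal {w : ℕ} (hw : 1 ≤ w) : 2 ^ (w - 1) ≤ mCal w := by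
  unfold mCal
  refine Nat.le_floor ?_
  have hmem : 1 ∈ Finset.Icc 1 w := Finset.mem_Icc.2 ⟨le_rfl, hw⟩
  have hle := Finset.single_le_sum (f := fun j : ℕ => (2 : ℚ) ^ (w - j) / (j : ℚ))
    (fun j hj => by
      have : (0 : ℚ) ≤ (j : ℚ) := by positivity
      positivity) hmem
  simpa using hle

/-- `1 ≤ mCal w` for `1 ≤ w`. -/
theorem one_le_mCal {w : ℕ} (hw : 1 ≤ w) : 1 ≤ mCal w :=
  (Nat.one_le_two_pow).trans (two_pow_le_mCal hw)

/-- `1 ≤ wOf n r` for `1 ≤ r`, `2 ≤ n`. -/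
theorem one_le_wOf {n r : ℕ} (hr : 1 ≤ r) (hn : 2 ≤ n) : 1 ≤ wOf n r := by
  unfold wOf
  have : 1 ≤ Nat.log 2 n := Nat.le_log_of_pow_le (by norm_num) (by simpa using hn)
  nlinarith

/-- `1 ≤ hP n r` for `1 ≤ r`, `2 ≤ n`. -/
theorem one_le_hP {n r : ℕ} (hr : 1 ≤ r) (hn : 2 ≤ n) : 1 ≤ hP n r := by
  unfold hP
  have hw := one_le_wOf hr hn
  have hm := one_le_mCal hw
  have h3 : 1 ≤ 3 ^ dCal (wOf n r) := Nat.one_le_pow _ _ (by norm_num)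
  calc 1 = 1 * 1 * 1 := by ring
    _ ≤ mCal (wOf n r) * wOf n r * 3 ^ dCal (wOf n r) :=
        Nat.mul_le_mul (Nat.mul_le_mul hm hw) h3

/-- An eventual statement in `w` transports along `w = wOf n r` (`r ≥ 1`) to an eventual statement in `n`. -/
theorem eventually_wOf {P : ℕ → Prop} (hP : ∀ᶠ w : ℕ in atTop, P w) {r : ℕ} (hr : 1 ≤ r) :
    ∀ᶠ n : ℕ in atTop, P (wOf n r) := by
  obtain ⟨W₀, hW₀⟩ := Filter.eventually_atTop.1 hP
  refine Filter.eventually_atTop.2 ⟨2 ^ W₀, fun n hn => hW₀ _ ?_⟩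
  unfold wOf
  have hlog : W₀ ≤ Nat.log 2 n := Nat.le_log_of_pow_le (by norm_num) hn
  nlinarith

/-- `halfFn` is monotone. -/
theorem halfFn_monotone (n kc r : ℕ) : Monotone (halfFn n kc r) := by
  intro x y hxy
  unfold halfFn
  exact tribesRM3_monotone _ _ _ fun b => cliqueFn_monotone_holds n kc fun e => hxy (b, e)

/-! ### The block-product weight -/

section Weight

variable {n kc r : ℕ}

/-- The engine's weight is nonnegative. -/
theorem halfWt_nonneg {μ : (Edge n → Bool) → ℝ} (hμ : ∀ z, 0 ≤ μ z) (x : HBlk n r × Edge n → Bool) :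
    0 ≤ bw (fun _ : HBlk n r => μ) (fun b e => x (b, e)) :=
  bw_nonneg (fun _ a => hμ a) _

/-- The engine's weight is FKG-lattice (`NegLimitedDoor.fkg_blockProduct`). -/
theorem halfWt_fkg {μ : (Edge n → Bool) → ℝ} (hμ0 : ∀ z, 0 ≤ μ z)
    (hμ : ∀ z z', μ z * μ z' ≤ μ (z ⊓ z') * μ (z ⊔ z')) (x y : HBlk n r × Edge n → Bool) :
    bw (fun _ : HBlk n r => μ) (fun b e => x (b, e)) * bw (fun _ : HBlk n r => μ) (fun b e => y (b, e)) ≤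
      bw (fun _ : HBlk n r => μ) (fun b e => (x ⊓ y) (b, e)) *
        bw (fun _ : HBlk n r => μ) (fun b e => (x ⊔ y) (b, e)) :=
  Summit.PneNP.PneNP.Theorems.NegLimitedDoor.fkg_blockProduct μ hμ0 hμ x y

/-- The engine's weight is a probability weight (`Amp.sum_bw_eq_prod`). -/
theorem sum_halfWt {μ : (Edge n → Bool) → ℝ} (hμ1 : ∑ z, μ z = 1) :
    ∑ x : HBlk n r × Edge n → Bool, bw (fun _ : HBlk n r => μ) (fun b e => x (b, e)) = 1 := by
  classical
  rw [← Fintype.sum_equiv (Equiv.curry (HBlk n r) (Edge n) Bool).symm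
    (fun X : HBlk n r → Edge n → Bool => bw (fun _ : HBlk n r => μ) X) _ (fun X => rfl), sum_bw_eq_prod]
  simp [hμ1]

/-- **Near balance, exactly**: under the block product of an exactly balanced `μ`, the mass of `halfFn = 1` is
`1 − (1 − 2^{-w})^m` (pushforward + the count C). -/
theorem massAt_halfWt_halfFn (hC : TribesRM3Count) {μ : (Edge n → Bool) → ℝ}
    (hμt : massAt μ (cliqueFn n kc) true = 1 / 2) (hμf : massAt μ (cliqueFn n kc) false = 1 / 2) :
    massAt (fun x : HBlk n r × Edge n → Bool => bw (fun _ : HBlk n r => μ) (fun b e => x (b, e)))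
      (halfFn n kc r) true = 1 - (1 - ((1 : ℝ) / 2) ^ wOf n r) ^ mCal (wOf n r) := by
  classical
  -- curry
  have h1 : massAt (fun x : HBlk n r × Edge n → Bool => bw (fun _ : HBlk n r => μ) (fun b e => x (b, e)))
      (halfFn n kc r) true =
      ∑ X : HBlk n r → Edge n → Bool, bw (fun _ : HBlk n r => μ) X *
        (fun v : HBlk n r → Bool =>
          if tribesRM3 (wOf n r) (mCal (wOf n r)) (dCal (wOf n r)) v = true then (1 : ℝ) else 0)
          (fun b => cliqueFn n kc (X b)) := by
    unfold massAt
    refine Fintype.sum_equiv (Equiv.curry (HBlk n r) (Edge n) Bool) _ _ fun x => ?_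
    change (if tribesRM3 (wOf n r) (mCal (wOf n r)) (dCal (wOf n r))
          (fun b => cliqueFn n kc fun e => x (b, e)) = true
        then bw (fun _ : HBlk n r => μ) (fun b e => x (b, e)) else 0) =
      bw (fun _ : HBlk n r => μ) (fun b e => x (b, e)) *
        (if tribesRM3 (wOf n r) (mCal (wOf n r)) (dCal (wOf n r))
          (fun b => cliqueFn n kc fun e => x (b, e)) = true then (1 : ℝ) else 0)
    split_ifs
    · rw [mul_one]
    · rw [mul_zero]
  -- pushforward
  have h2 := pushforward_holds (HBlk n r) (Edge n → Bool) (fun _ : HBlk n r => μ) (cliqueFn n kc)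
    (fun v : HBlk n r → Bool =>
      if tribesRM3 (wOf n r) (mCal (wOf n r)) (dCal (wOf n r)) v = true then (1 : ℝ) else 0)
  have hmass : ∀ b : Bool, massAt μ (cliqueFn n kc) b = 1 / 2 := fun b => by
    cases b
    · exact hμf
    · exact hμt
  have h3 : ∀ v : HBlk n r → Bool,
      (∏ w : HBlk n r, massAt ((fun _ : HBlk n r => μ) w) (cliqueFn n kc) (v w)) = ((1 : ℝ) / 2) ^ hP n r := by
    intro v
    rw [Finset.prod_congr rfl fun w _ => hmass (v w), Finset.prod_const, Finset.card_univ, card_HBlk]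
  rw [h1, h2, Finset.sum_congr rfl fun v _ => by rw [h3 v], ← Finset.mul_sum, Finset.sum_boole,
    hC (wOf n r) (mCal (wOf n r)) (dCal (wOf n r)), hP, ← mul_assoc, ← mul_pow,
    show ((1 : ℝ) / 2) * 2 = 1 by norm_num, one_pow, one_mul]

end Weight

/-! ### The stub -/

/-- **Registered stub `stub_halfEngineAssembly`** of the skeleton `half-window` (stmt-PneNP-19888): B + A-gen +
TB + N + C ⟹ the engine's output `HalfEngine`, with `e` from A-gen, `kc = k(c)` from B and
`K₃ = max K (K₂/2 + 1)`. -/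
theorem stub_halfEngineAssembly : HalfEngineAssembly := by
  intro hB hA hTB hN hC
  obtain ⟨β, hβ, hBc⟩ := hB
  obtain ⟨e, hAβ⟩ := hA
  obtain ⟨K, hK, hAK⟩ := hAβ β hβ
  refine ⟨e, fun ε₁ hε₁ r c hr => ?_⟩
  obtain ⟨kc, hkc3, hev⟩ := hBc c
  -- `β ≤ 1`: the base inequality is instantiated somewhere
  have hβ1 : β ≤ 1 := by
    obtain ⟨n, ⟨μ, hμ0, -, -, -, hhard⟩, hn1⟩ := (hev.and (eventually_ge_atTop 1)).exists
    classical
    obtain ⟨C, hC, hCs, -⟩ := (cktSize_const01 (ι := Edge n) MonoBasis.monotoneBasis01 true).toCircuit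
    have h := hhard C hC (hCs.trans (Nat.one_le_pow _ _ hn1))
    have h0 : 0 ≤ agreeAt μ (cliqueFn n kc) C.eval := by
      unfold agreeAt; exact Finset.sum_nonneg fun x _ => by split_ifs <;> simp [hμ0 x]
    linarith
  have hp0 : 0 < β / 2 := by positivity
  have hp1 : β / 2 ≤ 1 := by linarith
  obtain ⟨K₂, hK₂, hNw⟩ := hN ε₁ hε₁ (β / 2) hp0 hp1
  obtain ⟨K₃, hK₃⟩ : ∃ K₃ : ℝ, K₃ = max K (K₂ / 2 + 1) := ⟨_, rfl⟩
  have hK₃K : K ≤ K₃ := by rw [hK₃]; exact le_max_left _ _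
  have hK₃2 : K₂ / 2 + 1 ≤ K₃ := by rw [hK₃]; exact le_max_right _ _
  have hK₃0 : 0 < K₃ := lt_of_lt_of_le hK hK₃K
  refine ⟨kc, hkc3, K₃, hK₃0, ?_⟩
  filter_upwards [hev, eventually_wOf hNw hr, eventually_ge_atTop 2] with n hμ hNn hn2
  obtain ⟨μ, hμ0, hμfkg, hμt, hμf, hhard⟩ := hμ
  have hmass1 : ∑ z, μ z = 1 := by
    rw [← massAt_false_add_massAt_true μ (cliqueFn n kc), hμf, hμt]; norm_num
  -- the objects at this `n`
  have hcardW : (Fintype.card (HBlk n r) : ℝ) = hP n r := by exact_mod_cast card_HBlk n r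
  have hP1 : (1 : ℝ) ≤ hP n r := by exact_mod_cast one_le_hP hr hn2
  have hP0 : (0 : ℝ) < hP n r := by linarith
  obtain ⟨x, hx⟩ : ∃ x : ℝ, x = (hP n r : ℝ) ^ (-(1 / 2 - ε₁)) := ⟨_, rfl⟩
  rw [← hx]
  have hx0 : 0 < x := by rw [hx]; exact Real.rpow_pos_of_pos hP0 _
  have hinv : (hP n r : ℝ)⁻¹ ≤ x := by
    rw [hx, ← Real.rpow_neg_one]
    exact Real.rpow_le_rpow_of_exponent_le hP1 (by linarith)
  -- N at `w = wOf n r` reads on `hP n r`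
  have hNn' : tbRHS (wOf n r) (mCal (wOf n r)) (dCal (wOf n r)) (β / 2) ≤ K₂ * x := by
    have : (((mCal (wOf n r) * wOf n r * 3 ^ dCal (wOf n r) : ℕ) : ℝ)) = (hP n r : ℝ) := by
      rw [hP]
    rw [hx, ← this]; exact hNn
  -- the imbalance is half the first term of `tbRHS`
  have himb : |massAt (fun x : HBlk n r × Edge n → Bool => bw (fun _ : HBlk n r => μ) (fun b e => x (b, e)))
      (halfFn n kc r) true - 1 / 2| ≤ K₃ * x := by
    rw [massAt_halfWt_halfFn hC hμt hμf]
    have hfirst : |1 - (1 - ((1 : ℝ) / 2) ^ wOf n r) ^ mCal (wOf n r) - 1 / 2| =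
        (1 / 2) * |1 - 2 * (1 - ((1 : ℝ) / 2) ^ wOf n r) ^ mCal (wOf n r)| := by
      rw [show 1 - (1 - ((1 : ℝ) / 2) ^ wOf n r) ^ mCal (wOf n r) - 1 / 2 =
          (1 / 2) * (1 - 2 * (1 - ((1 : ℝ) / 2) ^ wOf n r) ^ mCal (wOf n r)) by ring, abs_mul]
      norm_num
    have hsqrt : 0 ≤ 2 * Real.sqrt ((1 - 2 * ((1 : ℝ) / 2) ^ wOf n r +
        (((1 : ℝ) / 2) ^ wOf n r) ^ 2 * (1 + Summit.PneNP.PneNP.Theorems.NegLimitedAmplifiedWindow.biasSeq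
          (β / 2) (dCal (wOf n r))) ^ wOf n r) ^ mCal (wOf n r)
          - (1 - ((1 : ℝ) / 2) ^ wOf n r) ^ (2 * mCal (wOf n r))) := by positivity
    have htb : |1 - 2 * (1 - ((1 : ℝ) / 2) ^ wOf n r) ^ mCal (wOf n r)| ≤
        tbRHS (wOf n r) (mCal (wOf n r)) (dCal (wOf n r)) (β / 2) := by
      unfold tbRHS; linarith
    rw [hfirst]
    have : (1 / 2) * (K₂ * x) ≤ K₃ * x := by linarith [mul_le_mul_of_nonneg_right hK₃2 hx0.le]
    linarith
  refine ⟨halfFn_monotone n kc r,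
    fun x : HBlk n r × Edge n → Bool => bw (fun _ : HBlk n r => μ) (fun b e => x (b, e)),
    halfWt_nonneg hμ0, halfWt_fkg hμ0 hμfkg, sum_halfWt hmass1,
    himb, fun M hM hMs => ?_⟩
  -- hardness via A-gen + TB + N
  have hsize : ((M.size : ℝ) + 1) * K * (Fintype.card (HBlk n r) : ℝ) ^ e ≤ ((n ^ c : ℕ) : ℝ) := by
    rw [hcardW]; push_cast
    calc ((M.size : ℝ) + 1) * K * (hP n r : ℝ) ^ e ≤ ((M.size : ℝ) + 1) * K₃ * (hP n r : ℝ) ^ e :=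
          mul_le_mul_of_nonneg_right (mul_le_mul_of_nonneg_left hK₃K (by positivity)) (pow_nonneg hP0.le e)
      _ ≤ (n : ℝ) ^ c := hMs
  have hAn := hAK (Edge n) (HBlk n r) μ (cliqueFn n kc)
    (tribesRM3 (wOf n r) (mCal (wOf n r)) (dCal (wOf n r))) (n ^ c) hμ0 hmass1
    (cliqueFn_monotone_holds n kc) hμt (tribesRM3_monotone _ _ _) hhard M hM hsize
  have hE := hTB (wOf n r) (mCal (wOf n r)) (dCal (wOf n r)) (β / 2) hp0 hp1
  change agreeAt (fun x : HBlk n r × Edge n → Bool => bw (fun _ : HBlk n r => μ) (fun b e => x (b, e)))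
    (halfFn n kc r) M.eval ≤ _ at hAn
  rw [hcardW] at hAn
  have hfin : expAbsBiasGen (tribesRM3 (wOf n r) (mCal (wOf n r)) (dCal (wOf n r))) (β / 2) / 2 +
      (hP n r : ℝ)⁻¹ ≤ K₃ * x := by
    have h1 : expAbsBiasGen (tribesRM3 (wOf n r) (mCal (wOf n r)) (dCal (wOf n r))) (β / 2) / 2 ≤
        K₂ / 2 * x := by linarith
    have h2 : (K₂ / 2 + 1) * x ≤ K₃ * x := mul_le_mul_of_nonneg_right hK₃2 hx0.le
    linarith [hinv]
  linarith
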